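import Literature.Analysis.FluidPDE.NSFourierBilinear
import Mathlib.Analysis.Fourier.FourierTransformDeriv
import Mathlib.Analysis.Fourier.Convolution
import Mathlib.Analysis.InnerProductSpace.Laplacian
import HarnessLib

/-!
# Dictionary between Fourier-side coefficient functions and their syntheses

Ninth file of the Fourier-side construction of Leray's local regular solution
(`Literature.Fluid.local_regular_solution`; plan in `NSLocalRegular`). For a coefficient function
`f : E → ℂ` (`E = EuclideanSpace ℝ ι`) with measurable, polynomially decaying values, the
synthesis `𝓕 f` (Mathlib's Fourier integral `𝓕 f x = ∫ 𝐞(-⟪ξ, x⟫) f ξ dξ`) obeys the classical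
dictionary used to verify the Navier–Stokes system term by term:

* linearity (`fourier_add'`, `fourier_sub'`, `fourier_const_mul'`, `fourier_finset_sum'`);
* `∂_h 𝓕 f = 𝓕 (-2πi⟪ξ, h⟫ f)` (`fderiv_fourier_apply'`, from Mathlib `Real.fderiv_fourier`);
* `Δ 𝓕 f = 𝓕 (-4π²‖ξ‖² f)` (`laplacian_fourier'`, from Mathlib `Real.iteratedFDeriv_fourier` and
  the orthonormal-basis formula for the Laplacian);
* products become convolutions, `𝓕 f · 𝓕 g = 𝓕 (f ⋆ g)` (`fourier_mul_fourier'`, Mathlib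
  `Real.fourier_mul_convolution_eq`);
* reality: `f(-ξ) = conj f(ξ)` implies `𝓕 f x ∈ ℝ` (`conj_fourier_eq_self`, `fourier_eq_re_of_conj_symm`);
* smoothness `𝓕 f ∈ C^n` for decay of order `n + K₀`, `K₀ > card ι` (`contDiff_fourier'`).

## Mathlib search

`Real.fourier_eq`, `Real.fderiv_fourier`, `Real.fourier_continuousLinearMap_apply`,
`Real.iteratedFDeriv_fourier`, `Real.fourier_continuousMultilinearMap_apply`,
`VectorFourier.fourierPowSMulRight_apply`, `VectorFourier.integrable_fourierPowSMulRight`,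
`InnerProductSpace.laplacian_eq_iteratedFDeriv_orthonormalBasis`,
`Real.fourier_mul_convolution_eq`, `Real.contDiff_fourier`, `integral_conj`, `integral_neg_eq_self`,
`Circle.starRingEnd_addChar` (`conj 𝐞(x) = 𝐞(-x)`).

## References

* E. M. Stein, G. Weiss, *Introduction to Fourier Analysis on Euclidean Spaces*, PUP 1971, Ch. I, §1.
-/

noncomputable section

open MeasureTheory Real Set Filter Topology Function Complex FourierTransform VectorFourier
  InnerProductSpace
open scoped FourierTransform RealInnerProductSpace ENNReal ContDiff ComplexConjugate Laplacian

namespace Literature.Analysis.FluidPDE.FourierNS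

variable {ι : Type*} [Fintype ι]

variable {K₀ : ℕ} {C : ℝ} {f g : EuclideanSpace ℝ ι → ℂ}

/-! ### Integrability from decay -/

/-- Integrability of the Fourier integrand at every point. [folklore] -/
theorem integrable_fourier_integrand (hf : Integrable f) (x : EuclideanSpace ℝ ι) :
    Integrable fun ξ : EuclideanSpace ℝ ι => 𝐞 (-⟪ξ, x⟫) • f ξ :=
  (Real.fourierIntegral_convergent_iff x).2 hf

/-- Moments of order `n` are integrable for decay of order `n + K₀`, `K₀ > card ι`. [folklore] -/
theorem integrable_moments {n : ℕ} (hK₀ : Fintype.card ι < K₀) (hf : HasDecay (n + K₀) C f)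
    (hfm : AEStronglyMeasurable f volume) :
    ∀ m ≤ n, Integrable (fun ξ : EuclideanSpace ℝ ι => ‖ξ‖ ^ m * ‖f ξ‖) := fun m hm =>
  (hf.of_le (by omega) : HasDecay (m + K₀) C f).integrable_pow_mul_norm
    (finrank_lt_of_card_lt hK₀) hfm

/-! ### Linearity -/

/-- `𝓕 (f + g) = 𝓕 f + 𝓕 g` pointwise, for integrable `f`, `g`. [folklore] -/
theorem fourier_add' (hf : Integrable f) (hg : Integrable g) (x : EuclideanSpace ℝ ι) :
    𝓕 (f + g) x = 𝓕 f x + 𝓕 g x := by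
  simp only [Real.fourier_eq, Pi.add_apply, smul_add]
  exact integral_add (integrable_fourier_integrand hf x) (integrable_fourier_integrand hg x)

/-- `𝓕 (f - g) = 𝓕 f - 𝓕 g` pointwise, for integrable `f`, `g`. [folklore] -/
theorem fourier_sub' (hf : Integrable f) (hg : Integrable g) (x : EuclideanSpace ℝ ι) :
    𝓕 (f - g) x = 𝓕 f x - 𝓕 g x := by
  simp only [Real.fourier_eq, Pi.sub_apply, smul_sub]
  exact integral_sub (integrable_fourier_integrand hf x) (integrable_fourier_integrand hg x)

/-- `𝓕 (c f) = c 𝓕 f` pointwise. [folklore] -/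
theorem fourier_const_mul' (c : ℂ) (f : EuclideanSpace ℝ ι → ℂ) (x : EuclideanSpace ℝ ι) :
    𝓕 (fun ξ => c * f ξ) x = c * 𝓕 f x := by
  simp only [Real.fourier_eq, Circle.smul_def, smul_eq_mul]
  rw [← integral_const_mul]
  congr 1 with ξ; ring

/-- `𝓕 (-f) = -𝓕 f` pointwise. [folklore] -/
theorem fourier_neg' (f : EuclideanSpace ℝ ι → ℂ) (x : EuclideanSpace ℝ ι) :
    𝓕 (fun ξ => -f ξ) x = -𝓕 f x := by
  simp only [Real.fourier_eq, smul_neg, integral_neg]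

/-- `𝓕 (∑ f_i) = ∑ 𝓕 f_i` pointwise, for integrable `f_i`. [folklore] -/
theorem fourier_finset_sum' {β : Type*} (s : Finset β) {F : β → EuclideanSpace ℝ ι → ℂ}
    (hF : ∀ b ∈ s, Integrable (F b)) (x : EuclideanSpace ℝ ι) :
    𝓕 (fun ξ => ∑ b ∈ s, F b ξ) x = ∑ b ∈ s, 𝓕 (F b) x := by
  simp only [Real.fourier_eq, Finset.smul_sum]
  rw [integral_finsetSum s fun b hb => integrable_fourier_integrand (hF b hb) x]

/-- The synthesis of the zero coefficient is zero. [folklore] -/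
theorem fourier_zero' (x : EuclideanSpace ℝ ι) : 𝓕 (fun _ : EuclideanSpace ℝ ι => (0 : ℂ)) x = 0 := by
  simp [Real.fourier_eq]

/-- Pointwise-equal coefficients have equal syntheses (for `rw` under binders). [folklore] -/
theorem fourier_congr' {f g : EuclideanSpace ℝ ι → ℂ} (h : ∀ ξ, f ξ = g ξ) : 𝓕 f = 𝓕 g := by
  rw [show f = g from funext h]

/-! ### Space derivatives -/

/-- Integrability of `fourierSMulRight (innerSL ℝ) f`. [folklore] -/
theorem integrable_fourierSMulRight' (hf : Integrable f)
    (hf1 : Integrable fun ξ : EuclideanSpace ℝ ι => ‖ξ‖ * ‖f ξ‖) :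
    Integrable (fourierSMulRight (innerSL ℝ) f) := by
  refine (hf1.const_mul (2 * π * ‖(innerSL ℝ : EuclideanSpace ℝ ι →L[ℝ]
    EuclideanSpace ℝ ι →L[ℝ] ℝ)‖)).mono' (hf.1.fourierSMulRight) (Eventually.of_forall fun ξ => ?_)
  exact (norm_fourierSMulRight_le _ f ξ).trans (le_of_eq (by ring))

/-- **`∂_h 𝓕 f = 𝓕 (-2πi⟪ξ, h⟫ f)`** for `f` with decay of order `1 + K₀` (Mathlib
`Real.fderiv_fourier`, evaluated). [folklore] -/
theorem fderiv_fourier_apply' (hK₀ : Fintype.card ι < K₀) (hf : HasDecay (1 + K₀) C f)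
    (hfm : AEStronglyMeasurable f volume) (x h : EuclideanSpace ℝ ι) :
    fderiv ℝ (𝓕 f) x h = 𝓕 (fun ξ => (-(2 * π * I) * (⟪ξ, h⟫ : ℂ)) * f ξ) x := by
  have hint : Integrable f := (hf.of_le (by omega) : HasDecay K₀ C f).integrable
    (finrank_lt_of_card_lt hK₀) hfm
  have hint1 : Integrable fun ξ : EuclideanSpace ℝ ι => ‖ξ‖ * ‖f ξ‖ := by
    simpa using integrable_moments (n := 1) hK₀ hf hfm 1 le_rfl
  rw [Real.fderiv_fourier hint hint1, Real.fourier_continuousLinearMap_apply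
    (integrable_fourierSMulRight' hint hint1)]
  have hfun : (fun ξ : EuclideanSpace ℝ ι => fourierSMulRight (innerSL ℝ) f ξ h) =
      fun ξ : EuclideanSpace ℝ ι => (-(2 * π * I) * (⟪ξ, h⟫ : ℂ)) * f ξ := by
    funext ξ
    change -(2 * π * I) • ((⟪ξ, h⟫ : ℝ) • f ξ) = _
    rw [Complex.real_smul, smul_eq_mul]
    ring
  rw [hfun]

/-- `𝓕 f` is differentiable for `f` with decay of order `1 + K₀`. [folklore] -/
theorem differentiable_fourier' (hK₀ : Fintype.card ι < K₀) (hf : HasDecay (1 + K₀) C f)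
    (hfm : AEStronglyMeasurable f volume) : Differentiable ℝ (𝓕 f) := by
  have hint : Integrable f := (hf.of_le (by omega) : HasDecay K₀ C f).integrable
    (finrank_lt_of_card_lt hK₀) hfm
  have hint1 : Integrable fun ξ : EuclideanSpace ℝ ι => ‖ξ‖ * ‖f ξ‖ := by
    simpa using integrable_moments (n := 1) hK₀ hf hfm 1 le_rfl
  exact Real.differentiable_fourier hint hint1

/-- **`𝓕 f ∈ C^n`** for decay of order `n + K₀` (Mathlib `Real.contDiff_fourier`). [folklore] -/
theorem contDiff_fourier' {n : ℕ} (hK₀ : Fintype.card ι < K₀) (hf : HasDecay (n + K₀) C f)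
    (hfm : AEStronglyMeasurable f volume) : ContDiff ℝ n (𝓕 f) :=
  Real.contDiff_fourier fun m hm => integrable_moments hK₀ hf hfm m (mod_cast hm)

/-! ### The Laplacian -/

/-- **`Δ 𝓕 f = 𝓕 (-4π²‖ξ‖² f)`** for `f` with decay of order `2 + K₀`: the orthonormal-basis
formula `Δ F = ∑ᵢ D²F [eᵢ, eᵢ]`, Mathlib's `iteratedFDeriv_fourier`, and `∑ᵢ ξᵢ² = ‖ξ‖²`. [folklore] -/
theorem laplacian_fourier' (hK₀ : Fintype.card ι < K₀) (hf : HasDecay (2 + K₀) C f)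
    (hfm : AEStronglyMeasurable f volume) (x : EuclideanSpace ℝ ι) :
    (Δ (𝓕 f)) x = 𝓕 (fun ξ => (-(4 * π ^ 2 * ‖ξ‖ ^ 2 : ℝ) : ℂ) * f ξ) x := by
  classical
  have hmom := integrable_moments hK₀ hf hfm
  have hint : Integrable f := (hf.of_le (by omega) : HasDecay K₀ C f).integrable
    (finrank_lt_of_card_lt hK₀) hfm
  rw [laplacian_eq_iteratedFDeriv_orthonormalBasis (𝓕 f) (EuclideanSpace.basisFun ι ℝ)]
  simp only
  rw [Real.iteratedFDeriv_fourier (N := (2 : ℕ)) (fun m hm => hmom m (mod_cast hm)) hfm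
    (n := 2) (mod_cast le_rfl)]
  have hI : Integrable fun ξ => fourierPowSMulRight (innerSL ℝ) f ξ 2 :=
    integrable_fourierPowSMulRight _ (hmom 2 le_rfl) hfm
  set g : ι → EuclideanSpace ℝ ι → ℂ := fun i ξ =>
    ((-(2 * π * I)) ^ 2 * ((ξ i : ℝ) : ℂ) ^ 2) * f ξ with hg
  have hterm : ∀ i : ι, 𝓕 (fun ξ => fourierPowSMulRight (innerSL ℝ) f ξ 2) x
      ![(EuclideanSpace.basisFun ι ℝ) i, (EuclideanSpace.basisFun ι ℝ) i] = 𝓕 (g i) x := by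
    intro i
    rw [Real.fourier_continuousMultilinearMap_apply hI]
    have hfun : (fun ξ : EuclideanSpace ℝ ι => fourierPowSMulRight (innerSL ℝ) f ξ 2
        ![(EuclideanSpace.basisFun ι ℝ) i, (EuclideanSpace.basisFun ι ℝ) i]) = g i := by
      funext ξ
      rw [fourierPowSMulRight_apply, Fin.prod_univ_two]
      simp only [Matrix.cons_val_zero, Matrix.cons_val_one]
      rw [EuclideanSpace.basisFun_apply]
      change (-(2 * π * I)) ^ 2 • ((⟪ξ, EuclideanSpace.single i (1 : ℝ)⟫ *
        ⟪ξ, EuclideanSpace.single i (1 : ℝ)⟫ : ℝ) • f ξ) = g i ξ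
      rw [EuclideanSpace.inner_single_right, Complex.real_smul, smul_eq_mul]
      simp only [hg, conj_trivial, one_mul, Complex.ofReal_mul]
      ring
    rw [hfun]
  simp_rw [hterm]
  have hfi : ∀ i ∈ (Finset.univ : Finset ι), Integrable (g i) := by
    intro i _
    have h2 := hmom 2 le_rfl
    refine (h2.const_mul (4 * π ^ 2)).mono' ?_ (Eventually.of_forall fun ξ => ?_)
    · exact ((Continuous.aestronglyMeasurable (by fun_prop)).mul hfm)
    · simp only [hg]
      rw [norm_mul, norm_mul, norm_pow, norm_neg, norm_mul, norm_mul, Complex.norm_two,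
        Complex.norm_real, Complex.norm_I, mul_one, Real.norm_eq_abs, abs_of_pos Real.pi_pos,
        norm_pow, Complex.norm_real, Real.norm_eq_abs]
      have h1 : |ξ i| ^ 2 ≤ ‖ξ‖ ^ 2 := pow_le_pow_left₀ (abs_nonneg _) (abs_apply_le_norm ξ i) 2
      calc (2 * π) ^ 2 * |ξ i| ^ 2 * ‖f ξ‖ ≤ (2 * π) ^ 2 * ‖ξ‖ ^ 2 * ‖f ξ‖ := by gcongr
        _ = 4 * π ^ 2 * (‖ξ‖ ^ 2 * ‖f ξ‖) := by ring
  rw [← fourier_finset_sum' Finset.univ hfi]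
  have hsum : (fun ξ : EuclideanSpace ℝ ι => ∑ b, g b ξ) =
      fun ξ => (-(4 * π ^ 2 * ‖ξ‖ ^ 2 : ℝ) : ℂ) * f ξ := by
    funext ξ
    change ∑ b, ((-(2 * π * I)) ^ 2 * ((ξ b : ℝ) : ℂ) ^ 2) * f ξ = _
    rw [← Finset.sum_mul]
    congr 1
    have hI2 : (-(2 * (π : ℂ) * I)) ^ 2 = -(4 * π ^ 2) := by
      rw [neg_sq, mul_pow, mul_pow, Complex.I_sq]; ring
    simp only [hI2]
    rw [← Finset.mul_sum, show (∑ i, ((ξ i : ℝ) : ℂ) ^ 2) = ((∑ i, (ξ i) ^ 2 : ℝ) : ℂ) by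
      push_cast; rfl, sum_sq_eq_norm_sq]
    push_cast
    ring
  rw [hsum]

/-! ### Products and reality -/

/-- **`𝓕 f · 𝓕 g = 𝓕 (f ⋆ g)`** for integrable `f`, `g` (Mathlib's convolution theorem
`Real.fourier_mul_convolution_eq`). [folklore] -/
theorem fourier_mul_fourier' (hf : Integrable f) (hg : Integrable g) (x : EuclideanSpace ℝ ι) :
    𝓕 f x * 𝓕 g x = 𝓕 (fconv f g) x :=
  (Real.fourier_mul_convolution_eq hf hg x).symm

/-- **Reality**: if `f(-ξ) = conj f(ξ)` then `conj (𝓕 f x) = 𝓕 f x`. [folklore] -/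
theorem conj_fourier_eq_self (hf : ∀ ξ, f (-ξ) = conj (f ξ)) (x : EuclideanSpace ℝ ι) :
    conj (𝓕 f x) = 𝓕 f x := by
  rw [Real.fourier_eq, ← integral_conj, ← integral_neg_eq_self _ volume]
  refine integral_congr_ae (Eventually.of_forall fun ξ => ?_)
  simp only [Circle.smul_def, smul_eq_mul, map_mul, inner_neg_left, neg_neg, Circle.starRingEnd_addChar,
    hf, Complex.conj_conj]

/-- The synthesis of a conjugation-symmetric coefficient is real: `𝓕 f x = ((𝓕 f x).re : ℂ)`. [folklore] -/
theorem fourier_eq_re_of_conj_symm (hf : ∀ ξ, f (-ξ) = conj (f ξ)) (x : EuclideanSpace ℝ ι) :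
    𝓕 f x = (((𝓕 f x).re : ℝ) : ℂ) :=
  (Complex.conj_eq_iff_re.1 (conj_fourier_eq_self hf x)).symm

end Literature.Analysis.FluidPDE.FourierNS

end
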